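import Mathlib
import HarnessLib
import HarnessLib.Audit
import Summits.Parity.Statement
import Summits.Parity.BatemanHorn.Statement
import HarnessLib.Audit.Status.Attr

/-!
Route: RoughValueTransport

DORMANT since 2026-08-24T02:11:24Z (reconciler: no traction for 6.4 d (last activity item-evidence-added at 2026-08-17T14:55:59Z); parked, not closed — `ledger route dormant route-Parity-RoughValueTransport --off` to reactivate) — unstaffed, not closed; items shared with open routes are served there. `ledger route dormant <id> --off` reactivates.

# Route RoughValueTransport — Bateman–Horn as the u = 2 boundary value of Buchstab's law along f:
shape (uω(u))^k with a free constant, constant transported from the fundamental lemma, boundary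
layer = balanced semiprimes

For a Bateman–Horn system f = (f_1,…,f_k) (`IsBatemanHornSystem f`) and a value-depth u put z_i :=
x^{deg f_i/u} and
Φ_f(x,u) := #{1 ≤ n ≤ x : for every i, f_i(n) > 0 and no prime p < x^{deg f_i/u} divides f_i(n)}
(jointly rough values, each coordinate sifted
to the SAME value-scale depth u: log f_i(n)/log z_i ≈ u). ω is Buchstab's function, written INLINE
(cone repair, rev 4): the items quantify over
every ω : ℝ → ℝ with ω(u) = 1/u on [1,2], ω continuous on [1,∞) and (uω(u))' = ω(u−1) for u > 2 — a
predicate with exactly one solution on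
[1,∞), the tree's `Literature.NumberTheory.Sieve.buchstabOmega` (existence: `buchstabOmega_eq_inv`,
`continuousOn_buchstabOmega`,
`hasDerivAt_mul_buchstabOmega`; uniqueness: method of steps — both machine-checked in the evidence
file SelfTest.lean), so that no item NAMES
`buchstabOmega` (whose home file imports BetaSieveForward → SieveFunctions → LevelOfDistribution)
and the route file imports nothing beyond the
sub-problem Statement. The spine card's one-parameter family B_f(u) ("Buchstab's law along f", there
for one f; here for systems) is
Φ_f(x,u) ~ (C(f)/∏ deg f_i)·(uω(u))^k·x/(log x)^k: for u ≤ 2 it IS the Bateman–Horn asymptotic for f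
(jointly rough = simultaneously prime), for
u → ∞ it is the fundamental lemma (a theorem), and the exponent k makes the shape (uω(u))^k
UNIVERSAL (checked numerically at filing for n²+1,
k = 1, and the twin system (X, X+2), k = 2). The route asks for NO rung u ≤ 2 and for NO value of
the constant. It suffices to show X = X1 ∧ X2:
(X1 = RoughValueLaw) for every system there is SOME constant A with Φ_f(x,u)·(log x)^k/x →
A·(uω(u))^k for every u > 2 (Buchstab SHAPE beyond the
prime threshold, constant free); (X2 = BalancedSemiprimeLayer) the boundary layer at u = 2⁺ is thin:
the jointly x^{deg f_i(1−δ)/2}-rough n that are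
not simultaneous prime values — necessarily n with some f_i(n) = p₁p₂, x^{deg f_i(1−δ)/2} ≤ p₁ ≤ p₂
("balanced semiprime in a coordinate") — number
≤ ε x/(log x)^k once δ ≤ δ(ε). Then the constant is FORCED: the fundamental lemma and Mertens for
ω_f pin EVERY family of rough-value limits L(u)
(u ≥ u₀) to L(u)/u^k → (C(f)/∏ deg f_i)·e^{−kγ} as u → ∞ (support SieveCalibration, stated for
arbitrary limits L, hence ω-free; C(f) =
`batemanHornConst f`, existence and positivity for every system = the PROVED tree fact
`IsBatemanHornSystem.hasBatemanHornConst_holds`);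
ω(u) → e^{−γ} (de Bruijn 1950 — PROVED in the tree since filing as
`harman2007_buchstabOmega_tendsto_holds`, hence no longer an item) gives
A = C(f)/∏ deg f_i, and u ↓ 2 ((uω(u))^k = (1 + log(u−1))^k → 1,
`buchstabOmega_eq_of_mem_Icc_two_three`) squeezes P_f(x) ~ (C(f)/∏ deg f_i)·x/(log x)^k
= `BatemanHornAsymptotic f` for every system, i.e. `_root_.BatemanHorn` (item Assembly; deciding
theorem `closes`). Realises cards
fixed-f-irregularity-parity-gated (spine: "B_f(U) runs from FL (U = ∞) to BH (U ≤ 2)") and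
rough-values-buchstab-parity (its RL(f,u), unsigned
part, u > 2). D-0027 §2.1-conforming successor of route BuchstabTransport (retired not-a-thesis: its
assembly stopped at HardyLittlewoodConjE).
Lean: `(∀ (k : ℕ) (f : Fin k → Polynomial ℤ), Literature.NumberTheory.Sieve.IsBatemanHornSystem f →
∀ ω : ℝ → ℝ, ((∀ u : ℝ, 1 ≤ u → u ≤ 2 → ω u = u⁻¹) ∧ ContinuousOn ω (Set.Ici 1) ∧ (∀ u : ℝ, 2 < u →
HasDerivAt (fun t : ℝ => t * ω t) (ω (u - 1)) u)) → ∃ A : ℝ, ∀ u : ℝ, 2 < u → Filter.Tendsto (fun x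
: ℕ => (((Finset.Icc 1 x).filter (fun n : ℕ => ∀ i, 0 < (f i).eval (n : ℤ) ∧ ∀ p ∈ Finset.range ⌈(x
: ℝ) ^ (((f i).natDegree : ℝ) / u)⌉₊, p.Prime → ¬ ((p : ℤ) ∣ (f i).eval (n : ℤ)))).card : ℝ) *
Real.log x ^ k / (x : ℝ)) Filter.atTop (nhds (A * (u * ω u) ^ k))) ∧ (∀ (k : ℕ) (f : Fin k →
Polynomial ℤ), Literature.NumberTheory.Sieve.IsBatemanHornSystem f → ∀ ε : ℝ, 0 < ε → ∃ δ : ℝ, 0 < δ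
∧ δ ≤ 1 / 4 ∧ ∀ᶠ x : ℕ in Filter.atTop, (((Finset.Icc 1 x).filter (fun n : ℕ => ∀ i, 0 < (f i).eval
(n : ℤ) ∧ ∀ p ∈ Finset.range ⌈(x : ℝ) ^ (((f i).natDegree : ℝ) * (1 - δ) / 2)⌉₊, p.Prime → ¬ ((p :
ℤ) ∣ (f i).eval (n : ℤ)))).card : ℝ) ≤ (Literature.NumberTheory.Sieve.polyPrimeCount f x : ℝ) + ε *
(x : ℝ) / Real.log x ^ k)`

## Assembly
Bookkeeping plus proved tree facts, system by system (k = 0 is the trivial system: both sides of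
every item collapse to constants 1). Fix a
system f with k ≥ 1 and D := ∏ deg f_i, and instantiate the items at ω := `buchstabOmega` (it
satisfies the inline predicate by
`buchstabOmega_eq_inv`, `continuousOn_buchstabOmega`, `hasDerivAt_mul_buchstabOmega`). From
RoughValueLaw take A and put L(u) := A·(uω(u))^k
(u ≥ 3); SieveCalibration gives L(u)/u^k = A·ω(u)^k → (C(f)/D)e^{−kγ}, the tree's
`harman2007_buchstabOmega_tendsto_holds` gives A·ω(u)^k →
A·e^{−kγ}, so A = C(f)/D (limits unique, e^{−kγ} ≠ 0). Upper bound: if every f_i(n) is a (positive)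
prime ≥ z_i then n is jointly rough, and prime
values f_i(n) < z_i = x^{deg f_i/u} force n ≪ x^{1/u+o(1)}, so P_f(x) ≤ Φ_f(x,u) + O(x^{1/2}) for u
∈ (2,3], whence limsup P_f(x)(log x)^k/x ≤
(C(f)/D)(uω(u))^k = (C(f)/D)(1 + log(u−1))^k (`buchstabOmega_eq_of_mem_Icc_two_three`) → C(f)/D as u
↓ 2. Lower bound: given ε,
BalancedSemiprimeLayer supplies δ ≤ 1/4; with u = 2/(1−δ) ∈ (2, 8/3] its left side is Φ_f(x,u) (the
exponents deg f_i(1−δ)/2 and deg f_i/u are the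
same real number), so P_f(x) ≥ Φ_f(x,u) − εx/(log x)^k eventually and liminf ≥ (C(f)/D)(1 +
log(u−1))^k − ε ≥ C(f)/D − ε. Hence P_f(x) ~
(C(f)/D)·x/(log x)^k with `HasBatemanHornConst f (batemanHornConst f)` from
`IsBatemanHornSystem.hasBatemanHornConst_holds`, i.e.
`BatemanHornAsymptotic f` (polyPrimeCount counts n from 0, Φ_f from 1: O(1)); quantifying over (k,
f) gives
`Literature.NumberTheory.Sieve.BatemanHornConjecture` = `_root_.BatemanHorn`. The deciding theorem
is
`closes : RoughValueLaw → BalancedSemiprimeLayer → SieveCalibration → Assembly → _root_.BatemanHorn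
:= fun h₁ h₂ h₃ h₄ => h₄ h₁ h₂ h₃` (glue.lean;
elaborates sorry-free with axioms propext/Classical.choice/Quot.sound, checked this session in
Sketch.lean).

Rationale: WHY THIS LINE. Mechanism: transport of the Bateman–Horn constant along Buchstab's delay equation —
the sieve KNOWS the constant at infinite depth (fundamental
lemma with coordinate-wise levels z_i: Φ_f(x,u) = x·∏_p(1 − g(p))·(1 + O(e^{−u/d_max})) with ∏_p(1 −
g(p)) ~ C(f)e^{−kγ}/∏_i log z_i = C(f)e^{−kγ}u^k/(∏ deg f_i
(log x)^k); PROVED tree inputs: `SieveSequence.fundamental_lemma_uniform_holds`,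
`IsBatemanHornSystem.hasBatemanHornConst_holds`, Mertens
`Literature.NumberTheory.LFunctions.Mertens.tendsto_log_mul_prod_one_sub_inv_nat`; the k = 1, f =
X²+1 instance of the limit is PROVED as
`Iwaniec1978.tendsto_densityProd_mul_log` after [IwaniecInventiones1978] §6), and the shape
hypothesis X1 carries it down to u = 2, where X2 hands over
to the primes; so the singular series is OUTPUT, not input — any proof of Buchstab shape with an
unidentified constant already yields Bateman–Horn
with the right one (the e^γ-corrected sieve heuristic of [Granville1995Irregularities] /
doi:10.1080/03461238.1995.10413946 made into a typed
conditional theorem; integer prototype = Buchstab–de Bruijn, PROVED in the tree as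
`exists_abs_card_roughIcc_sub_buchstab_le` after
[Lichtman2025LinearSieve] Lemma 6.1 — which IS RoughValueLaw for the system (X)). Imported areas:
(i) classical sieve asymptotics (delay-differential
equations: Buchstab's ω, [Harman2007] §1.4, Tenenbaum III.6; in the tree `buchstabOmega`,
`hasDerivAt_mul_buchstabOmega`,
`harman2007_buchstabOmega_tendsto_holds`); (ii) for X2, Type-I information BEYOND the trivial level
on the modulus side, degree by degree — deg 1:
switching + Bombieri–Vinogradov; deg 2: equidistribution of roots of quadratic congruences /
Kloosterman sums on average (doi:10.1007/bf02395047
Hooley 1967, doi:10.5802/aif.891 and [DeshouillersIwaniec1982], doi:10.4171/jems/951 de la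
Bretèche–Drappeau 2020, arXiv:1908.08816 Merikoski;
Iwaniec's Proposition 1 is PROVED in the tree as `Iwaniec1978.proposition1_holds`) and, through
Lagrange's identity (a²+b²)(c²+d²) = (ac−bd)² +
(ad+bc)², affine-sieve upper bounds on SL₂(ℤ) ([BourgainGamburdSarnak2009],
doi:10.1007/s11511-010-0057-4 Nevo–Sarnak): balanced semiprime values
n²+1 = p₁p₂ are unimodular matrices with two rows of prime norm in a skewed region and X2 is an
upper bound of the right order there; deg ≥ 3:
nothing is known (balanced factors exceed the number of terms). What prior routes do not do:
PolynomialMobius (the other all-systems route)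
relocates BH into a signed Möbius tail at one scale; this route deforms in the sieve depth u ∈ (2,
∞), removes the constant from the conjecture,
and isolates the u = 2 boundary layer as an UPPER-bound crux. REPAIR (rev 4, cone): rev ≤ 3 named
`buchstabOmega` (defined as
`BetaSieveForward.upper 1 2 1 + lower 1 2 1`) and `BetaSieveForward.upper/lower`, whose files import
SieveFunctions → LevelOfDistribution and with it
the unproved named facts `bfi_wellFactorable_level` and `LevelOfDistribution.ElliottHalberstam`,
none of which any item uses; rev 4 characterises ω
inline (same statements up to the machine-checked existence + uniqueness of Buchstab's function),
states SieveCalibration for arbitrary limit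
families, drops BuchstabLimit (now a PROVED Literature theorem the Assembly cites directly) and
WindowVsSignal (unused hypothesis of `closes`; its
numbers stay under NUMBERS), and imports only the sub-problem Statement — needs-fact: none.
Negatives index: empty at filing (2026-08-15).

RANKED CRUXES. #2 RoughValueLaw (crux) — Buchstab SHAPE of the jointly rough values of every
Bateman–Horn system beyond the prime threshold, constant free: for every system f of k polynomials
and for Buchstab's function ω — characterised inline by ω(u) = 1/u on [1,2], continuity on [1,∞) and
(uω(u))' = ω(u−1) for u > 2 (unique solution: the tree's `buchstabOmega`) — there is A ∈ ℝ such that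
for every u > 2, Φ_f(x,u)·(log x)^k/x → A·(uω(u))^k as x → ∞ (Φ_f as in the Thesis; spine card's
family B_f(U), U > 2; card rough-values-buchstab-parity's RL(f,u), unsigned; expected A = C(f)/∏ deg
f_i). It asserts nothing about prime values (u ≤ 2 excluded) and no value of A; for f = (X) it is
the tree's PROVED Buchstab–de Bruijn law; equivalent to rev-3 RoughValueLaw (same statement over the
named ω). [difficulty: open-problem] (why it might fail: BH-strength near u = 2 (rung u contains
P_f(x) as the fraction (1+log(u−1))^{-k} → 1 of Φ_f); at EVERY fixed u the law lies inside the
linear-sieve window (LinearSieveOptimality; numbers under NUMBERS): no Type-I input proves any rung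
for deg ≥ 2; an f-specific bias of rough values refutes it.) [Lichtman2025LinearSieve,
Tenenbaum2015, Harman2007, IwaniecInventiones1978, Granville1995Irregularities,
FriedlanderGranville1991, GranvilleSoundararajan2007Uncertainty, doi:10.1080/03461238.1995.10413946,
BatemanHorn1962]
#3 BalancedSemiprimeLayer (crux) — the boundary layer at u = 2⁺ is thin for every system: for every
ε > 0 there is δ ∈ (0, 1/4] such that for all large x, #{1 ≤ n ≤ x : ∀ i, f_i(n) > 0 and no prime p
< x^{deg f_i(1−δ)/2} divides f_i(n)} ≤ P_f(x) + ε x/(log x)^k (P_f = `polyPrimeCount f`). The excess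
counts the n with a BALANCED SEMIPRIME value f_i(n) = p₁p₂, x^{deg f_i(1−δ)/2} ≤ p₁ ≤ p₂, in some
coordinate (heuristically 2kδ·(C(f)/∏ deg f_i)·x/(log x)^k); for a quadratic coordinate these are
matrices (a,−b;c,d) ∈ SL₂(ℤ)-type lattice points with two prime row norms in a skewed region — an
affine-sieve UPPER bound of the right order, or an upper-bound sieve on the cofactor fed by roots of
quadratic congruences modulo p₁q (Kloosterman sums on average). Unchanged from rev 3 (item
stmt-Parity-9469). [difficulty: XL] (why it might fail: Degree-graded: deg 1 coordinates classical
(switching + Bombieri–Vinogradov); deg 2 needs roots mod p₁q for PRIME p₁ ~ x^{1−δ}, past Iwaniec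
Prop 1 (M ≤ x^{1−3ε}); deg ≥ 3 has balanced factors p₁ ~ x^{d(1−δ)/2} > x = #terms — no Type-I/II
information at all (FordMaynardLowLevel): open.) [doi:10.1007/bf02395047, doi:10.5802/aif.891,
DeshouillersIwaniec1982, doi:10.4171/jems/951, arXiv:1908.08816, IwaniecInventiones1978,
doi:10.1007/s11511-010-0057-4, BourgainGamburdSarnak2009, LiuSarnak2010, DukeFriedlanderIwaniec1995,
Toth2000]
#9 SieveCalibration (support) — the constant is fixed at infinite depth, for every system and
WHATEVER the rough-value limits are: if for all u ≥ u₀ the limit L(u) := lim_x Φ_f(x,u)·(log x)^k/x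
exists, then L(u)/u^k → (C(f)/∏ deg f_i)·e^{−kγ} as u → ∞ (ω-free restatement of rev-3
SieveCalibration, which had L(u) = A(uω(u))^k; the Assembly applies it with that L). Proof sketch
(provable now, size L): for fixed u and each x, sift (1_{n≤x}) by the prime-dependent forbidden
classes Ω_p = roots of ∏_{i : z_i > p} f_i (z_i = x^{deg f_i/u}) — a multiplicative density of
dimension ≤ k with constant K uniform in x (Mertens for the nested sub-systems {i : deg f_i ≥ d},
each again a Bateman–Horn system: PROVED `IsBatemanHornSystem.hasBatemanHornConst_holds` +
`tendsto_log_mul_prod_one_sub_inv_nat`), remainders |R_d| ≤ ω_f(d), level D = x^{1−ε}; the PROVED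
uniform fundamental lemma `SieveSequence.fundamental_lemma_uniform_holds` (constant depends on κ, K
only) gives Φ_f(x,u) = x·V·(1 + O(e^{−(1−ε)u/deg_max})) + O(x^{1−ε+o(1)}) with V·∏_i log z_i →
C(f)e^{−kγ}; so limsup/liminf of the ratio lie in (C(f)/∏ deg f_i)e^{−kγ}u^k·[1 ∓ K′e^{−u/deg_max}];
divide by u^k, let u → ∞ (k = 0: both sides are 1). [difficulty: provable-now] [Greaves2001,
IwaniecInventiones1978, Lichtman2025LinearSieve, BatemanHorn1962, Harman2007]

TWO-LAYER PLAN. Foreseen glued split of BalancedSemiprimeLayer by DEGREE once a prover lands the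
linear case: BalancedSemiprimeLayer ⇐ LayerLinear (all coordinates
of degree 1: switching + Bombieri–Vinogradov, provable) → LayerQuadratic (degree-2 coordinates:
Kloosterman / affine-sieve input beyond Iwaniec's
Proposition 1) → LayerHigher (degree ≥ 3: open, no Type-I information) → BalancedSemiprimeLayer
(glue: a system's layer is bounded by the sum over its
coordinates). No split of RoughValueLaw is foreseen: no transfer principle B(u+1) ⇒ B(u) exists
(Buchstab's identity along f brings in the descendant
polynomials f(pt+ν)/p, cf. card hecke-orbit-antiaveraging), and the spine card's N1 (window vs
signal, NUMBERS) shows each fixed rung is parity-gated.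

KILL CRITERIA. RoughValueLaw REFUTED at any single depth u > 2 for any single system — a theorem or
certified numerics showing Φ_f(x,u)(log x)^k/x converges to a
limit ≠ (C(f)/∏deg f_i)(uω(u))^k, equivalently Φ_f/(x·∏_p(1−g(p))·e^{kγ}ω(u)^k) ↛ 1, i.e. an
f-specific bias of rough values — closes the route
(`--reason refuted:RoughValueLaw`) and is news for every BatemanHorn route (the random model fails
along f); flag card rough-values-buchstab-parity.
(A refuter exhibits ω := buchstabOmega, which satisfies the inline predicate, and refutes the
∃A-clause for it.) BalancedSemiprimeLayer refuted for
some system (balanced semiprime values ≫ x/(log x)^k uniformly as δ → 0) contradicts the HL-type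
prediction 2kδ(C/D)x/(log x)^k: an anti-Bateman–Horn
phenomenon — close and file the Ω-statement on the negative side. SieveCalibration refuted ⇒ a
normalisation slip (constant C(f)/∏deg, exponents
deg f_i/u, the factor u^k) ⇒ PIVOT: re-derive and restate, do not close. PolynomialMobius'
PolyMobiusTail proved ⇒ superseded.

NOT DECOMPOSED YET. (i) Any attack on RoughValueLaw itself: the route is honest that no mechanism
for a fixed rung exists in degree ≥ 2 (spine card N1 with
LinearSieveOptimality); candidate non-Type-I inputs (Möbius randomness of the z-smooth part of f(n)
on the n with large smooth part; descendant
universality on average = Buchstab self-consistency of the profile) are layer-2 matters once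
BalancedSemiprimeLayer's linear case and SieveCalibration
land. (ii) The spine card's negative theorem N2 — fixed-f Friedlander–Granville irregularity for the
dilation family {f(qn+a)} at scale
(log height)^{u₀/deg f}, CONDITIONAL on RoughValueLaw for f at one u₀ with ω(u₀) ≠ e^{−γ} plus the
Maier-matrix column input — belongs to the negative
side (a conditional addendum to Literature.Barriers.Parity.UniformBatemanHornBarrier explaining its
scope caveat "nothing for any single polynomial");
not filed here; likewise the typed window-vs-signal lemma N1 (rev ≤ 3 support WindowVsSignal over
`BetaSieveForward.upper/lower 1 2 1`, dropped at
rev 4 as not load-bearing) is negative-side documentation, re-fileable over an inline linear-sieve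
pair if a refuter wants it typed. (iii) Rates:
uniformity in u and in f, second-order terms (the O(1/log z) drift seen numerically), the signed
(Liouville) half of rough-values-buchstab-parity.
(iv) A named light-import `def` of Buchstab's ω (Mathlib-only, method of steps) with a bridge lemma
`= buchstabOmega` on [1,∞) would let a tenure
pass shorten RoughValueLaw back to the named function; optional, not needed to typecheck (see
DEFINITION REQUESTS).

CHEAPEST FALSIFIER. Numerics of RoughValueLaw at u = 3 (where e^γω(3) = 1.00520 is the whole
Buchstab signal; at u = 4 it is already 1 + 2·10⁻⁶) in the drift-free
normalisation Φ_f/(x·∏_{p}(1−g(p))·e^{kγ}ω(u)^k) → 1. RUN AT FILING (pure python, root sieve /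
least-prime-factor sieve, < 10 s): f = X²+1
(k = 1, x = 10⁶): 0.9891, 0.9814, 1.0002, 0.9996, 1.0000, 1.0000 at u = 2.2, 2.5, 3, 4, 6, 10; f =
(X, X+2) (k = 2, x = 10⁷): 0.9746, 0.9655, 1.0011,
0.9999, 1.0000 at u = 2.2, 2.5, 3, 4, 6 — i.e. the +0.52 % (k = 1) and +1.04 % (k = 2) Buchstab
bumps at u = 3 are reproduced to 0.02 % / 0.07 %, with
the exponent k visible; the deficits at u ≤ 2.5 are the slowly converging boundary layer (balanced
semiprimes at small z). A refuter should push
to x = 10⁹ (k = 1) / 10¹⁰ (k = 2) and add a cubic (n³+2, x = 10^6.5): a converged deviation > 0.3 %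
at u = 3 kills the line. Second cheap check
(lookup): whether de la Bretèche–Drappeau's level of distribution for n²+1 (doi:10.4171/jems/951)
admits a PRIME modulus factor p₁ ~ x^{1−o(1)} times
q ≤ x^c; if only smooth/well-factorable moduli are covered, BalancedSemiprimeLayer's quadratic case
loses its named engine (demote, keep the route).

NUMBERS. 𝔖 = hardyLittlewoodEConst = 1.3728134628…, 𝔖/2 = Γ = 0.6864067 (n²+1: C(f)/deg = 𝔖/2); twin
system C(f) = 2C₂ = 1.3203236; e^{−γ} = 0.5614594836;
e^γω(u): 0.8905 (u = 2), 0.9572 (2.2), 1.0013 (2.5), 1.0052 (3), 1.000002 (4); ω(u) = 1/u on [1,2],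
(1 + log(u−1))/u on [2,3]
(`buchstabOmega_eq_of_mem_Icc_two_three`), 1/2 ≤ ω ≤ 1 (tree); (uω(u))^k − 1 ≈ k·log(u−1) on (2,3] =
predicted (one balanced coordinate)/(all prime) ratio,
→ 2kδ at z_i = x^{deg f_i(1−δ)/2}. Window vs signal (the dropped N1, [Greaves2001] ch. 4,
[Tenenbaum2015] III.6): linear-sieve window F(s) − f(s) =
2e^γρ(s−1)/s (ρ = Dickman): 0.3644 (s = 3), 0.0433 (s = 4); Maier signal |ω(U) − e^{−γ}| ≪ ρ(U−1)/U;
depth U/d is what level x buys in degree d, so the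
signal is smaller than the window ρ(U/2−1)/(U/2) by exp(−(½+o(1))U log U) in degree 2. Iwaniec 1978
Prop 1: Σ_{M<m<2M} B(x;m,N)² ≪ (1 + N^{7/2}M^{−5/4}x)x^{1+ε},
M < x (tree `Iwaniec1978.proposition1`), level MN ≈ x^{15/14} with M ≤ x^{1−3ε}; Hooley 1967:
P⁺(n²+1) > n^{11/10}; Deshouillers–Iwaniec 1982
(doi:10.5802/aif.891): n^{1.202}; Merikoski (arXiv:1908.08816): n^{1.279}. Raw filing counts:
Φ_{X²+1}(10⁶,u) = 58087, 68487, 83923, 110920, 162611,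
253847 (u = 2.2, 2.5, 3, 4, 6, 10), π_{n²+1}(10⁶) = 54110 (𝔖Σ1/log(n²+1) = 53970);
Φ_{(X,X+2)}(10⁷,u) = 68791, 95994, 142907, 245372, 494505
(u = 2.2, 2.5, 3, 4, 6), π₂(10⁷) = 58980 (2C₂Σ 1/(log n log(n+2)) = 58752).

DEFINITION REQUESTS. None needed to typecheck: every object exists in the tree or is written inline
(`Literature.NumberTheory.Sieve.IsBatemanHornSystem`, `…polyPrimeCount`,
`…batemanHornConst`, `Polynomial.eval/natDegree`, `Real.eulerMascheroniConstant`, `HasDerivAt`,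
`ContinuousOn`, `_root_.BatemanHorn`); the rough
count Φ_f is an inline decidable `Finset.filter`; Buchstab's ω is an inline predicate (3 clauses).
OPTIONAL library hygiene (operator / definer, not
filed as an item): `buchstabOmega` is DEFINED as `BetaSieveForward.upper 1 2 1 +
BetaSieveForward.lower 1 2 1`, and `BetaSieveForward.lean` imports
`SieveFunctions.lean` (→ LevelOfDistribution, SieveFramework); a Mathlib-only home for the forward
solution / for ω (method of steps) with the present
lemmas re-exported would make the NAMED function usable by routes without importing the unproved
`bfi_wellFactorable_level` /
`LevelOfDistribution.ElliottHalberstam` cone; then a tenure pass can restate RoughValueLaw over the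
name (equivalent by SelfTest.lean).

Novelty: Searches (2026-08-15, at filing; unchanged by the rev-4 repair, which alters no mathematical
content): `lit search "polynomial values without small
prime factors Buchstab asymptotic sieve" --source all` (local 1: arXiv:math/9807102 Martin, smooth
side; crossref 12: Wolke 1971
doi:10.4064/aa-19-4-327-333 and Dartyge–Tenenbaum–Martin 2002 doi:10.1023/a:1015237700066 = SMOOTH
values, Friedlander–Iwaniec 1997
doi:10.1073/pnas.94.4.1054 parity-sensitive sieve); crossref title searches locating
doi:10.4171/jems/951 (de la Bretèche–Drappeau 2020),
doi:10.1007/s11511-010-0057-4 (Nevo–Sarnak 2010), doi:10.1016/j.jnt.2018.04.013 (Horesh–Nevo 2018),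
doi:10.1007/bf02395047 (Hooley 1967),
doi:10.5802/aif.891 (Deshouillers–Iwaniec 1982), doi:10.1080/03461238.1995.10413946 (Granville
1995); `lean search` over the tree (buchstabOmega,
RoughNumbersBuchstab, BuchstabLimitFact, Iwaniec1978.*, fundamental_lemma_uniform,
hasBatemanHornConst_holds, MaierSieveOscillation, Barriers/Parity
catalogue incl. the PROVED Maier1985_shortIntervals); all BatemanHorn and GHL route files; cards
fixed-f-irregularity-parity-gated,
rough-values-buchstab-parity, maier-matrix-photograph, hecke-orbit-antiaveraging; `ledger negatives
--problem Parity` (0 at filing); the retired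
predecessor route-Parity-BuchstabTransport (same thesis for n²+1 only; retired not-a-thesis by the
D-0027 §2.1 audit, not on the mathematics).
Nearest prior art found: (a) the e^γ-corrected sieve heuristic for Hardy–Littlewood/Bateman–Horn con  [refs: 10.4064/aa-19-4-327-333, 10.1023/a:1015237700066, 10.1073/pnas.94.4.1054, 10.4171/jems/951, 10.1007/s11511-010-0057-4, 10.1016/j.jnt.2018.04.013, 10.1007/bf02395047, 10.5802/aif.891, 10.1080/03461238.1995.10413946, 10.1080/03461238.1995.10413946:, math/9807102, 1908.08816, doi:10.4064/aa-19-4-327-333, doi:10.1023/a, doi:10.1073/pnas.94.4.1054, doi:10.4171/jems/951, doi:10.1007/s11511-010-0057-4, d]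

Barriers (technique_class: buchstab, fundamental-lemma, kloosterman, affine-sieve): - technique_class: buchstab, fundamental-lemma, kloosterman, affine-sieve
- Literature.Barriers.Parity.SelbergParityBarrier: APPLIES to RoughValueLaw at every fixed u and is
NOT evaded — reweighting f(n) by 1 ± λ keeps all Type-I data and moves Φ_f(x,u) by the parity-split
Buchstab term (relative size ≍ |ρ′(u)|/(uω(u)) ≠ 0), so r2 is exactly where non-Type-I input must
enter; the route's content is the REDUCTION (constant and boundary layer are theorem-side), not an
evasion. It does not touch BalancedSemiprimeLayer at leading order (an upper bound of the right
order).
- Literature.Barriers.Parity.LinearSieveOptimality: APPLIES and is quantified by the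
window-vs-signal numbers (NUMBERS; rev ≤ 3 support WindowVsSignal, dropped at rev 4 as not
load-bearing): window ρ(u/d−1)/(u/d) at the depth level x buys in degree d, signal ≪ ρ(u−1)/u — no
dimension-one sieve with Selberg-type remainders proves any rung of r2 in degree ≥ 2; used as the
documented reason, not evaded. (Degree 1, single polynomial: the rung is Buchstab's THEOREM, proved
in the tree via the prime number theorem — the non-sieve input there is PNT.)
- Literature.Barriers.Parity.FordFixedLevelBarrier: consistent — level x^{1−ε} Type-I data are used
ONLY in SieveCalibration, to pin the constant at u = ∞ (where Ford's indeterminacy vanishes like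
e^{−u/d_max}), never to produce primes.
- Literature.Barriers.Parity.FordMaynardLowLevel: APPLIES to any Type-I/II attack on r2 (values of
one polynomial of degree ≥ 2 are a thi

Novelty grade: new-combination — route-review grade (refuter-rreview-0815T13-28-g3-0): NEW-COMBINATION. Nearest prior art: (a) Martin arXiv:math/9807102 (JNT 2002) — the SMOOTH-side dictionary: uniform BH/Schinzel (UH) ⇒ Ψ_F(x,x^{1/u}) ~ x∏ᵢρ(dᵢu) (Dickman shape, exponent by degree), i.e. prime values ⇒ friable-value shape; (b) Gra (refuter refuter-rreview-0815T13-28-g3-0, 2026-08-15T18:12:07Z; prior: arXiv:math/9807102, doi:10.1080/03461238.1995.10413946, Lichtman2025LinearSieve, Harman2007, BatemanHorn1962, IwaniecInventiones1978, DukeFriedlanderIwaniec1995, Toth2000, doi:10.4171/jems/951)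

History (route lifecycle, newest last):
- 2026-08-15T17:35:11Z · rev 4: restated RoughValueLaw (stmt-Parity-9468), SieveCalibration (stmt-Parity-9470), Assembly (stmt-Parity-9473) — route-repair (cone, gen 3): RE-ROUTED AROUND the LevelOfDistribution stack — needs-fact: none. Diagnosis: the only planner-controllable dirty import was Literat (planner-rrepair-Parity-RoughValueTransport-b4174857-g3-0)
- 2026-08-15T17:35:11Z · rev 4: dropped BuchstabLimit, WindowVsSignal — route-repair (cone, gen 3): RE-ROUTED AROUND the LevelOfDistribution stack — needs-fact: none. Diagnosis: the only planner-controllable dirty import was Literat (planner-rrepair-Parity-RoughValueTransport-b4174857-g3-0)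
- 2026-08-24T02:11:24Z · DORMANT — reconciler: no traction for 6.4 d (last activity item-evidence-added at 2026-08-17T14:55:59Z); parked, not closed — `ledger route dormant route-Parity-RoughValu (operator:999:373456)

sub-problem: BatemanHorn · status: dormant · opened planner-plancard-Parity-BatemanHorn-fixed-f-i-8290ce11-0 2026-08-15T13:58:15Z · rev 5 · ledger route-Parity-RoughValueTransport
GENERATED by the gate from the ledger (D-0016/17). Provers cite these decls: `theorem foo : Summit.Parity.BatemanHorn.Theses.RoughValueTransport.<Decl> := …` in Summits/Parity/BatemanHorn/Theorems/<Name>.lean.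
-/

namespace Summit.Parity.BatemanHorn.Theses.RoughValueTransport

open scoped BigOperators Topology Manifold Classical MeasureTheory ProbabilityTheory Matrix InnerProductSpace ComplexConjugate ContinuousMap
open Filter Set Function TopologicalSpace MeasureTheory

attribute [summit_statement] _root_.BatemanHorn

-- earlier RoughValueLaw (stmt-Parity-9468, replaced 2026-08-15T17:35:11Z -> stmt-Parity-11390): retired by None — ∀ (k : ℕ) (f : Fin k → Polynomial ℤ), Literature.NumberTheory.Sieve.IsBatemanHornSystem f → ∃ A : ℝ, ∀ u : ℝ, 2 < u → Filter.Tendsto (fun x : ℕ => (((Finset.Icc 1 x).filter (fun n : ℕ => ∀ i, 0 < (f i).eval (n : ℤ) ∧ ∀ p ∈ Finset.range ⌈(x : ℝ) ^ (((f i).natDegree : ℝ) / u)⌉₊, p.Prime → 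
/-- item stmt-Parity-11390 · crux · rank 2 · open · by planner
why it might fail: BH-strength near u = 2 (rung u contains P_f(x) as the fraction (1+log(u−1))^{-k} → 1 of Φ_f); at EVERY fixed u the law lies inside the linear-sieve window (LinearSieveOptimality; numbers under NUMBERS): no Type-I input proves any rung for deg ≥ 2; an f-specific bias of rough values refutes it.
sources: Lichtman2025LinearSieve, Tenenbaum2015, Harman2007, IwaniecInventiones1978, Granville1995Irregularities, FriedlanderGranville1991
[crux] Buchstab SHAPE of the jointly rough values of every Bateman–Horn system beyond the prime
threshold, constant free: for every system f of k polynomials and for Buchstab's function ω —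
characterised inline by ω(u) = 1/u on [1,2], continuity on [1,∞) and (uω(u))' = ω(u−1) for u > 2
(unique solution: the tree's `buchstabOmega`) — there is A ∈ ℝ such that for every u > 2,
Φ_f(x,u)·(log x)^k/x → A·(uω(u))^k as x → ∞ (Φ_f as in the Thesis; spine card's family B_f(U), U >
2; card rough-values-buchstab-parity's RL(f,u), unsigned; expected A = C(f)/∏ deg f_i). It asserts
nothing about prime values (u ≤ 2 excluded) and no value of A; for f = (X) it is the tree's PROVED
Buchstab–de Bruijn law; equivalent to rev-3 RoughValueLaw (same statement over the named ω).
[difficulty: open-problem] -/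
@[route_item "route-Parity-RoughValueTransport", crux]
def RoughValueLaw : Prop :=
  ∀ (k : ℕ) (f : Fin k → Polynomial ℤ), Literature.NumberTheory.Sieve.IsBatemanHornSystem f → ∀ ω : ℝ → ℝ, ((∀ u : ℝ, 1 ≤ u → u ≤ 2 → ω u = u⁻¹) ∧ ContinuousOn ω (Set.Ici 1) ∧ (∀ u : ℝ, 2 < u → HasDerivAt (fun t : ℝ => t * ω t) (ω (u - 1)) u)) → ∃ A : ℝ, ∀ u : ℝ, 2 < u → Filter.Tendsto (fun x : ℕ => (((Finset.Icc 1 x).filter (fun n : ℕ => ∀ i, 0 < (f i).eval (n : ℤ) ∧ ∀ p ∈ Finset.range ⌈(x : ℝ) ^ (((f i).natDegree : ℝ) / u)⌉₊, p.Prime → ¬ ((p : ℤ) ∣ (f i).eval (n : ℤ)))).card : ℝ) * Real.log x ^ k / (x : ℝ)) Filter.atTop (nhds (A * (u * ω u) ^ k))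

/-- item stmt-Parity-9469 · crux · rank 3 · open · by planner
why it might fail: Degree-graded: deg 1 coordinates classical (switching + Bombieri–Vinogradov); deg 2 needs roots mod p₁q for PRIME p₁ ~ x^{1−δ}, past Iwaniec Prop 1 (M ≤ x^{1−3ε}); deg ≥ 3 has balanced factors p₁ ~ x^{d(1−δ)/2} > x = #terms — no Type-I/II information at all (FordMaynardLowLevel): open.
sources: doi:10.1007/bf02395047, doi:10.5802/aif.891, DeshouillersIwaniec1982, doi:10.4171/jems/951, arXiv:1908.08816, IwaniecInventiones1978
[crux] the boundary layer at u = 2⁺ is thin for every system: for every ε > 0 there is δ ∈ (0, 1/4]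
such that for all large x, #{1 ≤ n ≤ x : ∀ i, f_i(n) > 0 and no prime p < x^{deg f_i(1−δ)/2} divides
f_i(n)} ≤ P_f(x) + ε x/(log x)^k (P_f = `polyPrimeCount f`). The excess counts the n with a BALANCED
SEMIPRIME value f_i(n) = p₁p₂, x^{deg f_i(1−δ)/2} ≤ p₁ ≤ p₂, in some coordinate (heuristically
2kδ·(C(f)/∏ deg f_i)·x/(log x)^k); for a quadratic coordinate these are matrices (a,−b;c,d) ∈
SL₂(ℤ)-type lattice points with two prime row norms in a skewed region — an affine-sieve UPPER bound
of the right order, or an upper-bound sieve on the cofactor fed by roots of quadratic congruences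
modulo p₁q (Kloosterman sums on average). [difficulty: XL] -/
@[route_item "route-Parity-RoughValueTransport", crux]
def BalancedSemiprimeLayer : Prop :=
  ∀ (k : ℕ) (f : Fin k → Polynomial ℤ), Literature.NumberTheory.Sieve.IsBatemanHornSystem f → ∀ ε : ℝ, 0 < ε → ∃ δ : ℝ, 0 < δ ∧ δ ≤ 1 / 4 ∧ ∀ᶠ x : ℕ in Filter.atTop, (((Finset.Icc 1 x).filter (fun n : ℕ => ∀ i, 0 < (f i).eval (n : ℤ) ∧ ∀ p ∈ Finset.range ⌈(x : ℝ) ^ (((f i).natDegree : ℝ) * (1 - δ) / 2)⌉₊, p.Prime → ¬ ((p : ℤ) ∣ (f i).eval (n : ℤ)))).card : ℝ) ≤ (Literature.NumberTheory.Sieve.polyPrimeCount f x : ℝ) + ε * (x : ℝ) / Real.log x ^ k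

-- earlier SieveCalibration (stmt-Parity-9470, replaced 2026-08-15T17:35:11Z -> stmt-Parity-11391): retired by None — ∀ (k : ℕ) (f : Fin k → Polynomial ℤ), Literature.NumberTheory.Sieve.IsBatemanHornSystem f → ∀ A : ℝ, (∃ u₀ : ℝ, ∀ u : ℝ, u₀ ≤ u → Filter.Tendsto (fun x : ℕ => (((Finset.Icc 1 x).filter (fun n : ℕ => ∀ i, 0 < (f i).eval (n : ℤ) ∧ ∀ p ∈ Finset.range ⌈(x : ℝ) ^ (((f i).natDegree : ℝ) / u
/-- item stmt-Parity-11391 · support · rank 9 · closed · proved by Summit.Parity.BatemanHorn.Theorems.sieveCalibration_proof @ 13583e5baf24 (prover) · by planner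
sources: Greaves2001, IwaniecInventiones1978, Lichtman2025LinearSieve, BatemanHorn1962, Harman2007
[support] the constant is fixed at infinite depth, for every system and WHATEVER the rough-value
limits are: if for all u ≥ u₀ the limit L(u) := lim_x Φ_f(x,u)·(log x)^k/x exists, then L(u)/u^k →
(C(f)/∏ deg f_i)·e^{−kγ} as u → ∞ (ω-free restatement of rev-3 SieveCalibration, which had L(u) =
A(uω(u))^k; the Assembly applies it with that L). Proof sketch (provable now, size L): for fixed u
and each x, sift (1_{n≤x}) by the prime-dependent forbidden classes Ω_p = roots of ∏_{i : z_i > p}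
f_i (z_i = x^{deg f_i/u}) — a multiplicative density of dimension ≤ k with constant K uniform in x
(Mertens for the nested sub-systems {i : deg f_i ≥ d}, each again a Bateman–Horn system: PROVED
`IsBatemanHornSystem.hasBatemanHornConst_holds` + `tendsto_log_mul_prod_one_sub_inv_nat`),
remainders |R_d| ≤ ω_f(d), level D = x^{1−ε}; the PROVED uniform fundamental lemma
`SieveSequence.fundamental_lemma_uniform_holds` (constant depends on κ, K only) gives Φ_f(x,u) =
x·V·(1 + O(e^{−(1−ε)u/deg_max})) + O(x^{1−ε+o(1)}) with V·∏_i log z_i → C(f)e^{−kγ}; so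
limsup/liminf of the ratio lie in (C(f)/∏ deg f_i)e^{−kγ}u^k·[1 ∓ K′e^{−u/deg_max}]; divide by u^k,
let u → ∞ (k = 0: both sides are 1). [difficulty: prov -/
@[route_item "route-Parity-RoughValueTransport", crux]
def SieveCalibration : Prop :=
  ∀ (k : ℕ) (f : Fin k → Polynomial ℤ), Literature.NumberTheory.Sieve.IsBatemanHornSystem f → ∀ L : ℝ → ℝ, (∃ u₀ : ℝ, ∀ u : ℝ, u₀ ≤ u → Filter.Tendsto (fun x : ℕ => (((Finset.Icc 1 x).filter (fun n : ℕ => ∀ i, 0 < (f i).eval (n : ℤ) ∧ ∀ p ∈ Finset.range ⌈(x : ℝ) ^ (((f i).natDegree : ℝ) / u)⌉₊, p.Prime → ¬ ((p : ℤ) ∣ (f i).eval (n : ℤ)))).card : ℝ) * Real.log x ^ k / (x : ℝ)) Filter.atTop (nhds (L u))) → Filter.Tendsto (fun u : ℝ => L u / u ^ k) Filter.atTop (nhds (Literature.NumberTheory.Sieve.batemanHornConst f / (∏ i, ((f i).natDegree : ℝ)) * Real.exp (-((k : ℝ) * Real.eulerMascheroniConstant))))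

-- earlier Assembly (stmt-Parity-9473, replaced 2026-08-15T17:35:11Z -> stmt-Parity-11392): retired by None — RoughValueLaw → BalancedSemiprimeLayer → SieveCalibration → BuchstabLimit → _root_.BatemanHorn
/-- item stmt-Parity-11392 · assembly · rank 1 · closed · proved by Summit.Parity.BatemanHorn.Theorems.roughValueTransportAssembly_proof @ 20a055b94c44 (prover) · by planner
sources: BatemanHorn1962, IwaniecInventiones1978, Lichtman2025LinearSieve, HardyLittlewood1923, Harman2007
[assembly] RoughValueLaw → BalancedSemiprimeLayer → SieveCalibration → BatemanHorn (the squeeze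
above, for every system, the items instantiated at ω := buchstabOmega; uses the PROVED tree theorems
harman2007_buchstabOmega_tendsto_holds, buchstabOmega_eq_of_mem_Icc_two_three,
IsBatemanHornSystem.hasBatemanHornConst_holds; real limits and ⌈·⌉₊ bookkeeping). -/
@[route_item "route-Parity-RoughValueTransport", crux]
def Assembly : Prop :=
  RoughValueLaw → BalancedSemiprimeLayer → SieveCalibration → _root_.BatemanHorn

/-! D-0027 §2.1 — DECIDING THEOREM (planner-authored via `route open/edit --closes-file`; by planner-rrepair-Parity-RoughValueTransport-b4174857-g3-0 2026-08-15T17:35:11Z):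
its hypotheses are this route's items and its conclusion the sub-problem Statement (glue_lint), and it elaborates with this file. -/

@[closes "route-Parity-RoughValueTransport"] theorem closes : RoughValueLaw → BalancedSemiprimeLayer → SieveCalibration → Assembly → _root_.BatemanHorn :=
  fun h₁ h₂ h₃ h₄ => h₄ h₁ h₂ h₃

end Summit.Parity.BatemanHorn.Theses.RoughValueTransport
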